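import Literature.Combinatorics.Optimization.LpFormulationReductions
import Literature.Computability.Complexity.MatchingExtensionComplexityHolds
import HarnessLib

/-!
# Matching over `3`-regular graphs has no small LPs (Braun–Pokutta–Roy 2016, §5)

G. Braun, S. Pokutta, A. Roy, *Strong reductions for extended formulations*, IPCO 2016 / Math. Program. 172
(2018) 591–620 [BraunPokuttaRoy2016]; locators are the arXiv:1512.04932v3 numbering (§2.1 Def. 2.10
`Matching(G)`, §2.3 Thm. 2.28 (the base problem `Matching(K_{2n})`, "[BP2014matchingJour], c.f. [Rothvoss]"),
§5 Thm. 5.1 and its proof).  **Thm. 5.1** (p. "A simple example"): "Let `n ∈ ℕ` and `0 ≤ ε < 1`. There exists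
a `3`-regular graph `D_{2n}` with `2n(2n−1)` vertices, so that
`fc(Matching(D_{2n}), ⌊|V(H)|/2⌋ + (1−ε)/2, OPT(H)) = 2^{Ω(√|V(D_{2n})|)}` … In particular, `Matching(D_{2n})` is
LP-hard with an inapproximability factor of `1 − ε/|V(D_{2n})|`."  The proof is "a simple application of the
reduction framework … it suffices to use the affine framework of [BPZ2015]": a reduction (Def. 3.1 with
`M₁ ≡ 1`, `M₂ ≡ 0`) from `Matching(K_{2n})` to `Matching(D_{2n})`, where `D_{2n}` is the disjoint union of cycles
`C^v` (`v ∈ V(K_{2n})`, vertices `[v,u]`, `u ≠ v`) plus an edge `([v,u],[u,v])` for every edge `{u,v}` of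
`K_{2n}`; `H ↦ H*` (the cycles of `V(H)` and the cross edges of `E(H)`), `M ↦ M*` (the cross edges of `M`
extended by the unique perfect matching of each path `C^v − [v, M(v)]`), with the value identity
`val_{H*}(M*) = |V(H)|(n−1) + val_H(M)` and `⌊|V(H)|(2n−1)/2⌋ = |V(H)|(n−1) + ⌊|V(H)|/2⌋`.

This file TYPES `Matching(G)` and `D_{2n}` in the tree's Braun–Pokutta–Zink vocabulary (`MaxProblem`,
`LPFormulation`, `MaxProblem.Reduction` of `SdpFormulationReductions.lean` / `LpFormulationReductions.lean`) and
PROVES (no named facts, no `sorry`):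

* `matchingProblem G t` — Def. 2.10 with the guarantees of Thm. 2.28 / Thm. 5.1: feasible solutions the perfect
  matchings `S` of `G` (spanning subgraphs `S ≤ G` with `S.IsPerfectMatching`, Mathlib), instances the subgraphs
  `H` of `G`, measure `val_H(S) = |S ∩ E(H)|` (`(S.edgeSet ∩ H.edgeSet).ncard`), `C(H) = ⌊|V(H)|/2⌋ + t`
  (natural-number division of `H.verts.ncard`), `S(H) = OPT(H)` (`matchingOpt`, the supremum of the finitely
  many values; every instance is sound, `matchingProblem_sound`).  The printed shift is `t = (1−ε)/2`.
* `two_mul_ncard_edgeSet_inter` — bookkeeping: `2|S ∩ E(H)| = #{x : the S-partner of x is an H-neighbour}`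
  (perfect matchings as partner maps, `Literature.Probability.LatticeModels.matchPartner`).
* **Base problem, Thm. 2.28 at the endpoint `ε → 1` (`t = 0`)** — `matchingKn_not_hasNonnegFactorization`,
  `matchingKn_lpFormulation_exp`: for some `c > 0` and all large even `n`, the `(⌊|V(H)|/2⌋, OPT)`-slack matrix
  of `Matching(K_n)` has no nonnegative factorization of size `≤ 2^{cn}`, hence (LP factorization theorem,
  `LPFormulation.isEmpty_of_not_hasNonnegFactorization`) no LP formulation of size `≤ 2^{cn}`.  Proof: its rows
  `H = K_n[U]`, `|U|` odd, read `⌊|U|/2⌋ − |S ∩ E[U]| = (|S ∩ δ(U)| − 1)/2` (`two_mul_slack_cliqueOn`, from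
  `|U| = 2|S ∩ E[U]| + |S ∩ δ(U)|`), half the odd-cut slack matrix of the perfect matching polytope, whose
  nonnegative rank is `2^{Ω(n)}` by Rothvoss's theorem — a TREE THEOREM,
  `Literature.Computability.Complexity.rothvoss_matching_slack_bound_holds` [Rothvoss2017, Thm. 1].
  RECORDED GAP (not a repair): the printed Thm. 2.28 / Thm. 5.1 cover `0 ≤ ε < 1`, i.e. every shift
  `t ∈ (0, 1/2]`, which are STRONGER lower bounds (`fc` decreases as `C` grows) resting on G. Braun, S. Pokutta,
  *The matching polytope does not admit fully-polynomial size relaxation schemes*, SODA 2015 (arXiv:1403.6710)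
  [BraunPokutta2014], Thm. 3.1 (held `paper:arxiv-1403.6710`, p. 10) — an information-theoretic (common-information) argument not in the tree; only the endpoint implied by
  Rothvoss's theorem is proved here (`-- TODO(general form)` at `matchingKn_not_hasNonnegFactorization`).  The
  reduction below is proved for EVERY `t`, so the printed range follows verbatim once that theorem lands.
* **The graph `D_N`** (`N = k + 2`) — `ThreeRegularMatching.dGraph k` on `DV k = Fin (k+2) × Fin (k+1)`, the
  vertex `[v,u]` encoded as `(v, i)` with `u = v.succAbove i` (so the cycle `C^v` runs through the `u ≠ v` in
  increasing order; "there is some ambiguity regarding the order of vertices in the cycles `C^v`, but this does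
  not affect the argument"); `card_DV`: `|V(D_N)| = N(N−1)`; `dGraph_isRegularOfDegree`: `D_N` is `3`-regular for
  `N ≥ 4` (`neighborFinset_eq`: the two cycle neighbours and the cross partner).
* **The reduction** — `instStar` (`H*`), `solPartner`/`solStar` (`M*`, a perfect matching of `D_N`:
  `solPartner_spec`), the value identity `two_mul_matchingVal_star`
  (`2 val_{H*}(M*) = 2 val_H(M) + (N−2)|V(H)|`), completeness `slack_eq`, and
  `ThreeRegularMatching.reduction k t : (matchingProblem K_N t).Reduction (matchingProblem D_N t)` (affine);
  `isEmpty_lpFormulation_of_Kn`: LP lower bounds for `Matching(K_N)` at shift `t` transfer to `Matching(D_N)`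
  at the same shift (Thm. 3.2 LP clause, `MaxProblem.Reduction.isEmpty_lpFormulation_affine`).
* **Thm. 5.1 at `ε → 1`, UNCONDITIONAL** — `threeRegularMatching_lpFormulation_exp`: for some `c > 0`, all large
  even `k` and all `R ≤ 2^{ck}`, `IsEmpty (LPFormulation (matchingProblem (dGraph k) 0) R)`;
  `threeRegularMatching_lpFormulation_exp_card`: the printed shape `R ≤ 2^{c√|V(D_N)|}`.

Not here: the SDP analogue (none is printed: the SDP complexity of matching is open beyond the symmetric case,
`BraunEtAl2016_symmetricSDP_matching`); the "no fully-polynomial size relaxation scheme for bounded degree"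
remark (needs the `t > 0` base); minimization/fractional problems (§4).
-/

noncomputable section

open Finset Filter
open scoped Classical

namespace Literature.Combinatorics.Optimization

open Literature.Probability.LatticeModels (matchPartner adj_matchPartner eq_matchPartner_of_adj
  matchPartner_matchPartner partnerSubgraph partnerSubgraph_isPerfectMatching perfectMatchingEquivPartner)
open Literature.Computability.Complexity (rothvoss_matching_slack_bound_holds)

/-! ### The maximum matching problem `Matching(G)` (Def. 2.10) -/

section MatchingProblem

variable {V : Type*}

/-- The feasible solutions of `Matching(G)`: "all perfect matchings `S` on `G`" (spanning subgraphs of `G`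
that are perfect matchings, Mathlib's `SimpleGraph.Subgraph.IsPerfectMatching`).
[cite: BraunPokuttaRoy2016, Def. 2.10 (arXiv v3)] -/
abbrev PerfectMatching (G : SimpleGraph V) : Type _ := {M : G.Subgraph // M.IsPerfectMatching}

/-- There are finitely many perfect matchings (they are partner maps `V → V`). [folklore] -/
private theorem PerfectMatching.finite [Finite V] (G : SimpleGraph V) : Finite (PerfectMatching G) :=
  Finite.of_equiv _ (perfectMatchingEquivPartner G).symm

/-- The measure of `Matching(G)`: "the size of induced matching `val_G(S) := |S ∩ E(H)|`" for a perfect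
matching `S` and a subgraph `H` of `G`. [cite: BraunPokuttaRoy2016, Def. 2.10 (arXiv v3)] -/
def matchingVal (G : SimpleGraph V) (H : G.Subgraph) (M : PerfectMatching G) : ℝ :=
  ((M.1.edgeSet ∩ H.edgeSet).ncard : ℝ)

/-- `OPT(H) = max_S val_H(S)` over the perfect matchings of `G` (a finite supremum; `0` if `G` has no
perfect matching). [cite: BraunPokuttaRoy2016, Def. 2.2 and Def. 2.10 (arXiv v3)] -/
def matchingOpt (G : SimpleGraph V) (H : G.Subgraph) : ℝ :=
  sSup (Set.range (matchingVal G H))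

/-- **`Matching(G)` with the guarantees of Thm. 2.28 / Thm. 5.1**: the maximization problem with instances
the subgraphs `H` of `G`, feasible solutions the perfect matchings `S` of `G`, measure `|S ∩ E(H)|`,
completeness guarantee `C(H) = ⌊|V(H)|/2⌋ + t` and soundness guarantee `S(H) = OPT(H)` (printed with
`t = (1 − ε)/2`, `0 ≤ ε < 1`; `t = 0` is the `ε → 1` endpoint).
[cite: BraunPokuttaRoy2016, Def. 2.10, Thm. 2.28 and Thm. 5.1 (arXiv v3)] -/
def matchingProblem (G : SimpleGraph V) (t : ℝ) : MaxProblem (PerfectMatching G) G.Subgraph where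
  val := matchingVal G
  C H := ((H.verts.ncard / 2 : ℕ) : ℝ) + t
  S := matchingOpt G

/-- Unfolding `val`. [cite: BraunPokuttaRoy2016, Def. 2.10 (arXiv v3)] -/
@[simp] theorem matchingProblem_val (G : SimpleGraph V) (t : ℝ) (H : G.Subgraph) (M : PerfectMatching G) :
    (matchingProblem G t).val H M = matchingVal G H M := rfl

/-- Unfolding `C`. [cite: BraunPokuttaRoy2016, Thm. 5.1 (arXiv v3)] -/
@[simp] theorem matchingProblem_C (G : SimpleGraph V) (t : ℝ) (H : G.Subgraph) :
    (matchingProblem G t).C H = ((H.verts.ncard / 2 : ℕ) : ℝ) + t := rfl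

/-- Unfolding `S`. [cite: BraunPokuttaRoy2016, Thm. 5.1 (arXiv v3)] -/
@[simp] theorem matchingProblem_S (G : SimpleGraph V) (t : ℝ) (H : G.Subgraph) :
    (matchingProblem G t).S H = matchingOpt G H := rfl

/-- Every instance is sound: `val_H(S) ≤ OPT(H)` ("the soundness guarantee is the optimal value").
[cite: BraunPokuttaRoy2016, proof of Thm. 5.1 (arXiv v3)] -/
theorem matchingProblem_sound [Finite V] (G : SimpleGraph V) (t : ℝ) (H : G.Subgraph) :
    (matchingProblem G t).Sound H := by
  haveI := PerfectMatching.finite G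
  exact fun M => le_csSup (Set.finite_range (matchingVal G H)).bddAbove ⟨M, rfl⟩

/-- **Counting `|S ∩ E(H)|` through the partner map**: twice the number of edges of the perfect matching `S`
inside `H` is the number of vertices whose partner is an `H`-neighbour. [folklore] -/
private theorem two_mul_ncard_edgeSet_inter [Fintype V] {G : SimpleGraph V} (H : G.Subgraph) (M : PerfectMatching G) :
    2 * (M.1.edgeSet ∩ H.edgeSet).ncard = (univ.filter fun x => H.Adj x (matchPartner M.2 x)).card := by
  have hff : ∀ x, matchPartner M.2 (matchPartner M.2 x) = x := matchPartner_matchPartner M.2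
  set T := univ.filter fun x => H.Adj x (matchPartner M.2 x) with hT
  let g : V → Sym2 V := fun x => s(x, matchPartner M.2 x)
  have hfT : ∀ x ∈ T, matchPartner M.2 x ∈ T := fun x hx => by
    simp only [hT, mem_filter, mem_univ, true_and] at hx ⊢
    rw [hff]
    exact hx.symm
  have hset : M.1.edgeSet ∩ H.edgeSet = ↑(T.image g) := by
    ext e
    simp only [Set.mem_inter_iff, coe_image, Set.mem_image, mem_coe, hT, mem_filter, mem_univ, true_and]
    constructor
    · intro ⟨hM, hH⟩
      induction e using Sym2.ind with
      | h x y =>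
        have hy : y = matchPartner M.2 x := eq_matchPartner_of_adj M.2 (SimpleGraph.Subgraph.mem_edgeSet.1 hM)
        subst hy
        exact ⟨x, SimpleGraph.Subgraph.mem_edgeSet.1 hH, rfl⟩
    · rintro ⟨x, hx, rfl⟩
      exact ⟨SimpleGraph.Subgraph.mem_edgeSet.2 (adj_matchPartner M.2 x), SimpleGraph.Subgraph.mem_edgeSet.2 hx⟩
  rw [hset, Set.ncard_coe_finset]
  have hmaps : Set.MapsTo g ↑T ↑(T.image g) := fun x hx => by
    simp only [coe_image]
    exact Set.mem_image_of_mem g hx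
  rw [card_eq_sum_card_fiberwise hmaps]
  have hfib : ∀ e ∈ T.image g, (T.filter fun a => g a = e).card = 2 := by
    intro e he
    obtain ⟨a, ha, rfl⟩ := mem_image.1 he
    have hne : a ≠ matchPartner M.2 a := G.ne_of_adj (M.1.adj_sub (adj_matchPartner M.2 a))
    have : (T.filter fun x => g x = g a) = {a, matchPartner M.2 a} := by
      ext x
      simp only [mem_filter, mem_insert, mem_singleton]
      constructor
      · rintro ⟨-, h⟩
        rcases Sym2.eq_iff.1 h with ⟨h1, -⟩ | ⟨h1, -⟩
        · exact Or.inl h1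
        · exact Or.inr h1
      · rintro (rfl | rfl)
        · exact ⟨ha, rfl⟩
        · refine ⟨hfT a ha, ?_⟩
          show s(matchPartner M.2 a, matchPartner M.2 (matchPartner M.2 a)) = s(a, matchPartner M.2 a)
          rw [hff, Sym2.eq_swap]
    rw [this, card_pair hne]
  rw [sum_congr rfl hfib, sum_const, smul_eq_mul, mul_comm]

/-- `2·val_H(S) = #{x : partner(x) is an H-neighbour of x}`. [folklore] -/
private theorem two_mul_matchingVal [Fintype V] {G : SimpleGraph V} (H : G.Subgraph) (M : PerfectMatching G) :
    2 * matchingVal G H M = ((univ.filter fun x => H.Adj x (matchPartner M.2 x)).card : ℝ) := by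
  rw [matchingVal, ← two_mul_ncard_edgeSet_inter H M]
  push_cast
  ring

/-- `|V(H)|` as a finite cardinality. [folklore] -/
private theorem ncard_verts_eq [Fintype V] {G : SimpleGraph V} (H : G.Subgraph) :
    H.verts.ncard = (univ.filter fun v => v ∈ H.verts).card := by
  rw [← Set.ncard_coe_finset]
  congr 1
  ext v
  simp

end MatchingProblem

/-! ### The base problem `Matching(K_n)`: exponential LP complexity at `t = 0` (Rothvoss; Thm. 2.28) -/

section Base

variable {n : ℕ}

/-- The instance `K_n[U]`: the subgraph of `K_n` induced on the vertex set `U`.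
[cite: BraunPokuttaRoy2016, proof of Thm. 2.28 via [Rothvoss2017] (arXiv v3)] -/
def cliqueOn (U : Finset (Fin n)) : (⊤ : SimpleGraph (Fin n)).Subgraph :=
  (⊤ : (⊤ : SimpleGraph (Fin n)).Subgraph).induce ↑U

/-- `V(K_n[U]) = U`. [folklore] -/
@[simp] private theorem cliqueOn_verts (U : Finset (Fin n)) : (cliqueOn U).verts = ↑U := rfl

/-- Adjacency in `K_n[U]`. [folklore] -/
private theorem cliqueOn_adj (U : Finset (Fin n)) (x y : Fin n) :
    (cliqueOn U).Adj x y ↔ x ∈ U ∧ y ∈ U ∧ x ≠ y := by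
  simp [cliqueOn, SimpleGraph.Subgraph.induce_adj]

/-- **`|U| = 2|S ∩ E[U]| + |S ∩ δ(U)|`** for a perfect matching `S` of `K_n`: every vertex of `U` is
matched either inside `U` or across `δ(U)`. [folklore] -/
private theorem two_mul_matchingVal_cliqueOn_add_crossing (U : Finset (Fin n))
    (M : PerfectMatching (⊤ : SimpleGraph (Fin n))) :
    2 * matchingVal ⊤ (cliqueOn U) M + Literature.Computability.Complexity.Rothvoss.crossing U M.1 = U.card := by
  rw [two_mul_matchingVal, Literature.Computability.Complexity.Rothvoss.crossing_eq_card_filter U M.2]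
  have h1 : (univ.filter fun x => (cliqueOn U).Adj x (matchPartner M.2 x)) =
      U.filter fun x => matchPartner M.2 x ∈ U := by
    ext x
    simp only [mem_filter, mem_univ, true_and, cliqueOn_adj]
    constructor
    · rintro ⟨hx, hy, -⟩; exact ⟨hx, hy⟩
    · rintro ⟨hx, hy⟩
      exact ⟨hx, hy, (SimpleGraph.top_adj _ _).1 (M.1.adj_sub (adj_matchPartner M.2 x))⟩
  rw [h1]
  have h2 := card_filter_add_card_filter_not (s := U) (fun x => matchPartner M.2 x ∈ U)
  have h3 : (U.filter fun x => ¬ matchPartner M.2 x ∈ U) = U.filter fun x => matchPartner M.2 x ∉ U :=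
    filter_congr fun _ _ => Iff.rfl
  rw [h3] at h2
  exact_mod_cast h2

/-- **The slack of `K_n[U]` at `t = 0` is half the odd-cut slack**: for `|U|` odd and a perfect matching `S`,
`⌊|U|/2⌋ − |S ∩ E[U]| = (|S ∩ δ(U)| − 1)/2`. [cite: BraunPokuttaRoy2016, Thm. 2.28 via [Rothvoss2017, §2] (arXiv v3)] -/
theorem two_mul_slack_cliqueOn (U : Finset (Fin n)) (hU : Odd U.card)
    (M : PerfectMatching (⊤ : SimpleGraph (Fin n))) :
    2 * ((matchingProblem (⊤ : SimpleGraph (Fin n)) 0).slackMatrix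
        ⟨cliqueOn U, matchingProblem_sound _ _ _⟩ M) =
      (Literature.Computability.Complexity.Rothvoss.crossing U M.1 : ℝ) - 1 := by
  have h := two_mul_matchingVal_cliqueOn_add_crossing U M
  obtain ⟨j, hj⟩ := hU
  have hdiv : U.card / 2 = j := by omega
  simp only [MaxProblem.slackMatrix_apply, matchingProblem_C, matchingProblem_val, cliqueOn_verts,
    Set.ncard_coe_finset, hdiv, add_zero]
  have hjr : (U.card : ℝ) = 2 * j + 1 := by exact_mod_cast hj
  linarith

/-- **Thm. 2.28 at the endpoint `ε → 1` (= Rothvoss's Theorem 1 in the optimization-problem language):**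
for some `c > 0` and all large even `n`, the `(⌊|V(H)|/2⌋, OPT)`-slack matrix of `Matching(K_n)` has no
nonnegative factorization of size `≤ 2^{cn}` — its rows `K_n[U]`, `|U|` odd, form half the odd-cut slack
matrix `|S ∩ δ(U)| − 1` of the perfect matching polytope, whose nonnegative rank is `2^{Ω(n)}`
(`Literature.Computability.Complexity.rothvoss_matching_slack_bound_holds`).
-- TODO(general form): the printed Thm. 2.28 [BP2014matchingJour = BraunPokutta2014 (SODA 2015, arXiv:1403.6710), Thm. 3.1]
-- covers every `t = (1−ε)/2 ∈ (0, 1/2]` (a STRONGER lower bound); its information-theoretic proof is not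
-- in the tree, so only the endpoint `t = 0` implied by Rothvoss's theorem is proved here.
[cite: BraunPokuttaRoy2016, Thm. 2.28 (arXiv v3)] [cite: Rothvoss2017, Thm. 1] -/
theorem matchingKn_not_hasNonnegFactorization :
    ∃ c : ℝ, 0 < c ∧ ∀ᶠ n : ℕ in atTop, Even n → ∀ r : ℕ, (r : ℝ) ≤ 2 ^ (c * n) →
      ¬ HasNonnegFactorization (matchingProblem (⊤ : SimpleGraph (Fin n)) 0).slackMatrix r := by
  obtain ⟨c, hc, hev⟩ := rothvoss_matching_slack_bound_holds
  refine ⟨c, hc, hev.mono fun n hn heven r hr hfac => ?_⟩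
  obtain ⟨A, B, hA, hB, hAB⟩ := hfac
  refine hn heven r hr (fun U i => 2 * A ⟨cliqueOn U, matchingProblem_sound _ _ _⟩ i)
    (fun M i => if h : M.IsPerfectMatching then B i ⟨M, h⟩ else 0)
    (fun U i => mul_nonneg zero_le_two (hA _ _)) (fun M i => ?_) fun U M hU hM => ?_
  · by_cases h : M.IsPerfectMatching
    · simp only [dif_pos h]; exact hB _ _
    · simp only [dif_neg h]; exact le_rfl
  · change (Literature.Computability.Complexity.Rothvoss.crossing U M : ℝ) - 1 = _
    rw [← two_mul_slack_cliqueOn U hU ⟨M, hM⟩, hAB, mul_sum]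
    refine sum_congr rfl fun i _ => ?_
    simp only [dif_pos hM]
    ring

/-- For `c > 0`, eventually `2^{(c/2)n} + 2 ≤ 2^{cn}`. [folklore] -/
private theorem eventually_rpow_half_add_two_le {c : ℝ} (hc : 0 < c) :
    ∀ᶠ n : ℕ in atTop, (2 : ℝ) ^ (c / 2 * n) + 2 ≤ 2 ^ (c * n) := by
  filter_upwards [eventually_ge_atTop ⌈2 / c⌉₊] with n hn
  have hn' : 2 / c ≤ n := (Nat.le_ceil _).trans (by exact_mod_cast hn)
  have h1 : 1 ≤ c / 2 * n := by
    have : c / 2 * (2 / c) = 1 := by field_simp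
    rw [← this]
    exact mul_le_mul_of_nonneg_left hn' (by positivity)
  set x : ℝ := 2 ^ (c / 2 * (n : ℝ)) with hx
  have hx2 : 2 ≤ x := by
    calc (2 : ℝ) = 2 ^ (1 : ℝ) := (Real.rpow_one 2).symm
      _ ≤ 2 ^ (c / 2 * n) := Real.rpow_le_rpow_of_exponent_le one_le_two h1
  have hsq : (2 : ℝ) ^ (c * n) = x ^ 2 := by
    rw [hx, ← Real.rpow_natCast, ← Real.rpow_mul zero_le_two]
    congr 1
    push_cast
    ring
  rw [hsq]
  nlinarith

/-- **`Matching(K_n)` has no `(⌊|V(H)|/2⌋, OPT)`-approximate LP formulation of size `2^{o(n)}`** (Thm. 2.28 at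
`ε → 1`, via the LP factorization theorem): for some `c > 0` and all large even `n`, there is no LP formulation
of size `≤ 2^{cn}`. [cite: BraunPokuttaRoy2016, Thm. 2.28 (arXiv v3)] [cite: Rothvoss2017, Thm. 1] -/
theorem matchingKn_lpFormulation_exp :
    ∃ c : ℝ, 0 < c ∧ ∀ᶠ n : ℕ in atTop, Even n → ∀ R : ℕ, (R : ℝ) ≤ 2 ^ (c * n) →
      IsEmpty (LPFormulation (matchingProblem (⊤ : SimpleGraph (Fin n)) 0) R) := by
  obtain ⟨c, hc, hev⟩ := matchingKn_not_hasNonnegFactorization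
  refine ⟨c / 2, half_pos hc, ?_⟩
  filter_upwards [hev, eventually_rpow_half_add_two_le hc] with n hn h2 heven R hR
  refine LPFormulation.isEmpty_of_not_hasNonnegFactorization (hn heven (R + 1) ?_)
  push_cast
  linarith

end Base

/-! ### The `3`-regular graphs `D_{2n}` and the reduction (Thm. 5.1) -/

namespace ThreeRegularMatching

variable {k : ℕ}

/-- The vertices `[v,u]` (`v ≠ u`) of `D_N`, `N = k + 2`, encoded as pairs `(v, i)` with `u = v.succAbove i`:
vertex `v` of `K_N` and a position `i` on the cycle `C^v` of length `N − 1 = k + 1`.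
[cite: BraunPokuttaRoy2016, proof of Thm. 5.1, item 1 (arXiv v3)] -/
abbrev DV (k : ℕ) : Type := Fin (k + 2) × Fin (k + 1)

/-- `|V(D_N)| = N(N−1)`. [cite: BraunPokuttaRoy2016, Thm. 5.1 (arXiv v3)] -/
theorem card_DV (k : ℕ) : Fintype.card (DV k) = (k + 2) * (k + 1) := by
  simp

/-- The position of `v ≠ u` on the cycle `C^u` (inverse of `u.succAbove`). [folklore] -/
def idx (u v : Fin (k + 2)) (h : v ≠ u) : Fin (k + 1) := (finSuccAboveEquiv u).symm ⟨v, h⟩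

/-- `u.succAbove (idx u v) = v`. [folklore] -/
@[simp] private theorem succAbove_idx (u v : Fin (k + 2)) (h : v ≠ u) : u.succAbove (idx u v h) = v := by
  have := (finSuccAboveEquiv u).apply_symm_apply ⟨v, h⟩
  rw [finSuccAboveEquiv_apply] at this
  exact congrArg Subtype.val this

/-- `idx u (u.succAbove i) = i`. [folklore] -/
@[simp] private theorem idx_succAbove (u : Fin (k + 2)) (i : Fin (k + 1)) (h : u.succAbove i ≠ u) :
    idx u (u.succAbove i) h = i := by
  have := (finSuccAboveEquiv u).symm_apply_apply i
  rw [finSuccAboveEquiv_apply] at this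
  exact this

/-- `idx` does not depend on the proof and respects equality of vertices. [folklore] -/
private theorem idx_congr {u v v' : Fin (k + 2)} (hv : v = v') (h : v ≠ u) (h' : v' ≠ u) : idx u v h = idx u v' h' := by
  subst hv; rfl

/-- The cross edge partner: `[v,u] ↦ [u,v]`. [cite: BraunPokuttaRoy2016, proof of Thm. 5.1, item 2 (arXiv v3)] -/
def cross (x : DV k) : DV k :=
  (x.1.succAbove x.2, idx (x.1.succAbove x.2) x.1 (Fin.succAbove_ne x.1 x.2).symm)

/-- First coordinate of `cross`. [folklore] -/
@[simp] private theorem cross_fst (x : DV k) : (cross x).1 = x.1.succAbove x.2 := rfl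

/-- A cross edge changes the `K_N`-vertex. [folklore] -/
private theorem cross_fst_ne (x : DV k) : (cross x).1 ≠ x.1 := Fin.succAbove_ne x.1 x.2

/-- `idx` respects equality of the base vertex. [folklore] -/
private theorem idx_congr_left {u u' w : Fin (k + 2)} (hu : u = u') (h : w ≠ u) (h' : w ≠ u') :
    idx u w h = idx u' w h' := by
  subst hu; rfl

/-- `cross` is an involution. [folklore] -/
@[simp] private theorem cross_cross (x : DV k) : cross (cross x) = x := by
  obtain ⟨v, i⟩ := x
  have h1 : (v.succAbove i).succAbove (idx (v.succAbove i) v (Fin.succAbove_ne v i).symm) = v :=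
    succAbove_idx _ _ _
  refine Prod.ext h1 ?_
  show idx ((v.succAbove i).succAbove (idx (v.succAbove i) v (Fin.succAbove_ne v i).symm)) (v.succAbove i) _ = i
  exact (idx_congr_left h1 _ (Fin.succAbove_ne v i)).trans (idx_succAbove v i _)

/-- The next vertex on the cycle `C^v`. [cite: BraunPokuttaRoy2016, proof of Thm. 5.1, item 1 (arXiv v3)] -/
def nxt (x : DV k) : DV k := (x.1, x.2 + 1)

/-- The previous vertex on the cycle `C^v`. [cite: BraunPokuttaRoy2016, proof of Thm. 5.1, item 1 (arXiv v3)] -/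
def prv (x : DV k) : DV k := (x.1, x.2 - 1)

/-- First coordinate of `nxt`. [folklore] -/
@[simp] private theorem nxt_fst (x : DV k) : (nxt x).1 = x.1 := rfl
/-- First coordinate of `prv`. [folklore] -/
@[simp] private theorem prv_fst (x : DV k) : (prv x).1 = x.1 := rfl
/-- Second coordinate of `nxt`. [folklore] -/
@[simp] private theorem nxt_snd (x : DV k) : (nxt x).2 = x.2 + 1 := rfl
/-- Second coordinate of `prv`. [folklore] -/
@[simp] private theorem prv_snd (x : DV k) : (prv x).2 = x.2 - 1 := rfl
/-- `prv ∘ nxt = id`. [folklore] -/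
@[simp] private theorem prv_nxt (x : DV k) : prv (nxt x) = x := by simp [prv, nxt]
/-- `nxt ∘ prv = id`. [folklore] -/
@[simp] private theorem nxt_prv (x : DV k) : nxt (prv x) = x := by simp [prv, nxt]

/-- The generating relation of `D_N`: cycle successor and cross partner. [cite: BraunPokuttaRoy2016, proof of Thm. 5.1 (arXiv v3)] -/
abbrev dRel (x y : DV k) : Prop := y = nxt x ∨ y = cross x

/-- **The graph `D_N`** (`N = k + 2`): the disjoint union of the cycles `C^v` (`v ∈ V(K_N)`, vertices `[v,u]`,
`u ≠ v`, of length `N − 1`) together with an edge `([v,u],[u,v])` for every edge `{u,v}` of `K_N`.  (An `abbrev`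
over `SimpleGraph.fromRel`, so that adjacency is decidable by instance search and `degree` needs no choice.)
[cite: BraunPokuttaRoy2016, proof of Thm. 5.1, items 1–2 (arXiv v3)] -/
abbrev dGraph (k : ℕ) : SimpleGraph (DV k) := SimpleGraph.fromRel dRel

/-- Adjacency in `D_N`. [cite: BraunPokuttaRoy2016, proof of Thm. 5.1 (arXiv v3)] -/
theorem dGraph_adj (x y : DV k) :
    (dGraph k).Adj x y ↔ x ≠ y ∧ (y = nxt x ∨ y = cross x ∨ x = nxt y ∨ x = cross y) := by
  rw [dGraph, SimpleGraph.fromRel_adj, dRel, dRel, or_assoc]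

/-- Cycle successors are adjacent. [folklore] -/
private theorem adj_nxt {x : DV k} (h : x ≠ nxt x) : (dGraph k).Adj x (nxt x) :=
  (dGraph_adj _ _).2 ⟨h, Or.inl rfl⟩

/-- Cycle predecessors are adjacent. [folklore] -/
private theorem adj_prv {x : DV k} (h : x ≠ prv x) : (dGraph k).Adj x (prv x) :=
  (dGraph_adj _ _).2 ⟨h, Or.inr (Or.inr (Or.inl (nxt_prv x).symm))⟩

/-- Cross partners are adjacent. [folklore] -/
private theorem adj_cross (x : DV k) : (dGraph k).Adj x (cross x) :=
  (dGraph_adj _ _).2 ⟨fun h => cross_fst_ne x (by rw [← h]), Or.inr (Or.inl rfl)⟩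

/-- The cycle successor on positions. [folklore] -/
private theorem val_nxt_snd (x : DV k) : ((nxt x).2 : ℕ) = if (x.2 : ℕ) = k then 0 else (x.2 : ℕ) + 1 := by
  rw [nxt_snd, Fin.val_add_one]
  split_ifs with h1 h2 h2
  · rfl
  · exact absurd (by rw [h1, Fin.val_last]) h2
  · exact absurd (Fin.ext (by rw [h2, Fin.val_last])) h1
  · rfl

/-- The cycle predecessor on positions. [folklore] -/
private theorem val_prv_snd (x : DV k) : ((prv x).2 : ℕ) = if (x.2 : ℕ) = 0 then k else (x.2 : ℕ) - 1 := by
  rw [prv_snd, Fin.coe_sub_one]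
  split_ifs with h1 h2 h2
  · rfl
  · exact absurd (by rw [h1, Fin.val_zero]) h2
  · exact absurd (Fin.ext (by rw [h2, Fin.val_zero])) h1
  · rfl

/-- On a cycle of length `≥ 2` the successor moves. [folklore] -/
private theorem nxt_ne (hk : 1 ≤ k) (x : DV k) : x ≠ nxt x := by
  intro h
  have hv : ((x.2 : ℕ)) = ((nxt x).2 : ℕ) := by rw [← h]
  rw [val_nxt_snd] at hv
  have hx : (x.2 : ℕ) ≤ k := Nat.lt_succ_iff.1 x.2.isLt
  split_ifs at hv <;> omega

/-- On a cycle of length `≥ 2` the predecessor moves. [folklore] -/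
private theorem prv_ne (hk : 1 ≤ k) (x : DV k) : x ≠ prv x := fun h =>
  nxt_ne hk (prv x) (by rw [nxt_prv]; exact h.symm)

/-- On a cycle of length `≥ 3` successor and predecessor differ. [folklore] -/
private theorem nxt_ne_prv (hk : 2 ≤ k) (x : DV k) : nxt x ≠ prv x := by
  intro h
  have hv : ((nxt x).2 : ℕ) = ((prv x).2 : ℕ) := by rw [h]
  rw [val_nxt_snd, val_prv_snd] at hv
  have hx : (x.2 : ℕ) ≤ k := Nat.lt_succ_iff.1 x.2.isLt
  split_ifs at hv <;> omega

/-- The neighbourhood of a vertex of `D_N` for `N ≥ 4`: its two cycle neighbours and its cross partner.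
[cite: BraunPokuttaRoy2016, proof of Thm. 5.1 ("obviously `3`-regular") (arXiv v3)] -/
theorem neighborFinset_eq (hk : 2 ≤ k) (x : DV k) :
    (dGraph k).neighborFinset x = {nxt x, prv x, cross x} := by
  have hnx : x ≠ nxt x := nxt_ne (by omega) x
  have hpx : x ≠ prv x := prv_ne (by omega) x
  ext y
  rw [SimpleGraph.mem_neighborFinset, dGraph_adj, mem_insert, mem_insert, mem_singleton]
  constructor
  · rintro ⟨-, h | h | h | h⟩
    · exact Or.inl h
    · exact Or.inr (Or.inr h)
    · exact Or.inr (Or.inl (by rw [h, prv_nxt]))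
    · exact Or.inr (Or.inr (by rw [h, cross_cross]))
  · rintro (rfl | rfl | rfl)
    · exact ⟨hnx, Or.inl rfl⟩
    · exact ⟨hpx, Or.inr (Or.inr (Or.inl (nxt_prv x).symm))⟩
    · exact ⟨fun h => cross_fst_ne x (by rw [← h]), Or.inr (Or.inl rfl)⟩

/-- **`D_N` is `3`-regular** (for `N ≥ 4`, i.e. cycles of length `≥ 3`).
[cite: BraunPokuttaRoy2016, Thm. 5.1 ("a `3`-regular graph `D_{2n}` with `2n(2n−1)` vertices") (arXiv v3)] -/
theorem dGraph_isRegularOfDegree (hk : 2 ≤ k) : (dGraph k).IsRegularOfDegree 3 := by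
  intro x
  rw [SimpleGraph.degree, neighborFinset_eq hk]
  have h1 : nxt x ∉ ({prv x, cross x} : Finset (DV k)) := by
    rw [mem_insert, mem_singleton, not_or]
    exact ⟨nxt_ne_prv hk x, fun h => cross_fst_ne x (by rw [← h, nxt_fst])⟩
  have h2 : prv x ≠ cross x := fun h => cross_fst_ne x (by rw [← h, prv_fst])
  rw [card_insert_of_notMem h1, card_pair h2]

/-! ### The reduction from `Matching(K_N)` to `Matching(D_N)` (proof of Thm. 5.1) -/

/-- **The image `H*` of an instance**: "the union of the `C^v` for `v ∈ H` together with the edges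
`([u,v],[v,u])` for `{u,v} ∈ E(H)`". [cite: BraunPokuttaRoy2016, proof of Thm. 5.1 (arXiv v3)] -/
def instStar (H : (⊤ : SimpleGraph (Fin (k + 2))).Subgraph) : (dGraph k).Subgraph where
  verts := {x | x.1 ∈ H.verts}
  Adj x y := (dGraph k).Adj x y ∧ ((x.1 = y.1 ∧ x.1 ∈ H.verts) ∨ H.Adj x.1 y.1)
  adj_sub h := h.1
  edge_vert := by
    rintro x y ⟨-, ⟨-, h⟩ | h⟩
    · exact h
    · exact H.edge_vert h
  symm := ⟨by
    rintro x y ⟨hd, ⟨h1, h2⟩ | h⟩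
    · exact ⟨hd.symm, Or.inl ⟨h1.symm, h1 ▸ h2⟩⟩
    · exact ⟨hd.symm, Or.inr h.symm⟩⟩

/-- Adjacency in `H*`. [cite: BraunPokuttaRoy2016, proof of Thm. 5.1 (arXiv v3)] -/
theorem instStar_adj (H : (⊤ : SimpleGraph (Fin (k + 2))).Subgraph) (x y : DV k) :
    (instStar H).Adj x y ↔ (dGraph k).Adj x y ∧ ((x.1 = y.1 ∧ x.1 ∈ H.verts) ∨ H.Adj x.1 y.1) := Iff.rfl

/-- Vertices of `H*`. [cite: BraunPokuttaRoy2016, proof of Thm. 5.1 (arXiv v3)] -/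
@[simp] theorem mem_instStar_verts (H : (⊤ : SimpleGraph (Fin (k + 2))).Subgraph) (x : DV k) :
    x ∈ (instStar H).verts ↔ x.1 ∈ H.verts := Iff.rfl

/-- `|V(H*)| = (N − 1)·|V(H)|`. [cite: BraunPokuttaRoy2016, proof of Thm. 5.1 ("a total of `2n(2n−1)` vertices") (arXiv v3)] -/
theorem ncard_instStar_verts (H : (⊤ : SimpleGraph (Fin (k + 2))).Subgraph) :
    (instStar H).verts.ncard = (k + 1) * (univ.filter fun v => v ∈ H.verts).card := by
  rw [ncard_verts_eq]
  have : (univ.filter fun x : DV k => x ∈ (instStar H).verts) =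
      (univ.filter fun v : Fin (k + 2) => v ∈ H.verts) ×ˢ (univ : Finset (Fin (k + 1))) := by
    ext x
    simp
  rw [this, card_product, card_univ, Fintype.card_fin, mul_comm]

section Sol

variable (M : PerfectMatching (⊤ : SimpleGraph (Fin (k + 2))))

/-- A perfect matching of `K_N` moves every vertex. [folklore] -/
private theorem partner_ne (v : Fin (k + 2)) : matchPartner M.2 v ≠ v :=
  ((SimpleGraph.top_adj _ _).1 (M.1.adj_sub (adj_matchPartner M.2 v))).symm

/-- `K_N` has a perfect matching only for even `N`, i.e. even `k`. [folklore] -/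
private theorem even_k (M : PerfectMatching (⊤ : SimpleGraph (Fin (k + 2)))) : Even k := by
  have h := M.2.even_card
  rw [Fintype.card_fin] at h
  obtain ⟨j, hj⟩ := h
  exact ⟨j - 1, by omega⟩

/-- The position of the matched vertex `[v, M(v)]` on the cycle `C^v`. [cite: BraunPokuttaRoy2016, proof of Thm. 5.1 (arXiv v3)] -/
def pos (v : Fin (k + 2)) : Fin (k + 1) := idx v (matchPartner M.2 v) (partner_ne M v)

/-- `[v, M(v)]` sits at position `pos v`. [folklore] -/
@[simp] private theorem succAbove_pos (v : Fin (k + 2)) : v.succAbove (pos M v) = matchPartner M.2 v :=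
  succAbove_idx _ _ _

/-- The cross edge at `[v, M(v)]` leads to `[M(v), v]`, the matched position of the cycle `C^{M(v)}`. [folklore] -/
private theorem cross_pos (v : Fin (k + 2)) :
    cross (v, pos M v) = (matchPartner M.2 v, pos M (matchPartner M.2 v)) := by
  have h1 : v.succAbove (pos M v) = matchPartner M.2 v := succAbove_pos M v
  refine Prod.ext h1 ?_
  show idx (v.succAbove (pos M v)) v _ =
    idx (matchPartner M.2 v) (matchPartner M.2 (matchPartner M.2 v)) _
  exact (idx_congr_left h1 _ (partner_ne M v).symm).trans
    (idx_congr (matchPartner_matchPartner M.2 v).symm _ _)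

/-- The offset of a cycle vertex from the matched position (in `{0, …, N−2}`). [folklore] -/
def off (x : DV k) : ℕ := ((x.2 - pos M x.1 : Fin (k + 1)) : ℕ)

/-- Offsets are `< N − 1`. [folklore] -/
private theorem off_le (x : DV k) : off M x ≤ k := Nat.lt_succ_iff.1 (Fin.isLt _)

/-- Offset `0` is the matched position. [folklore] -/
private theorem off_eq_zero_iff (x : DV k) : off M x = 0 ↔ x.2 = pos M x.1 := by
  rw [off, Fin.val_eq_zero_iff, sub_eq_zero]

/-- The successor increases the offset (away from the wrap-around). [folklore] -/
private theorem off_nxt (x : DV k) (h : off M x < k) : off M (nxt x) = off M x + 1 := by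
  have e : (nxt x).2 - pos M (nxt x).1 = (x.2 - pos M x.1) + 1 := add_sub_right_comm _ _ _
  unfold off at h ⊢
  rw [e, Fin.val_add_one]
  split_ifs with hl
  · rw [hl, Fin.val_last] at h; exact absurd h (lt_irrefl _)
  · rfl

/-- The predecessor decreases a nonzero offset. [folklore] -/
private theorem off_prv (x : DV k) (h : off M x ≠ 0) : off M (prv x) = off M x - 1 := by
  have e : (prv x).2 - pos M (prv x).1 = (x.2 - pos M x.1) - 1 := sub_right_comm _ _ _
  unfold off at h ⊢
  rw [e, Fin.coe_sub_one]
  split_ifs with h0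
  · rw [h0, Fin.val_zero] at h; exact absurd rfl h
  · rfl

/-- **The partner map of `M*`**: `[v, M(v)] ↔ [M(v), v]` along the cross edges, and on each cycle `C^v` minus
its matched vertex (a path with an even number `N − 2` of vertices) the unique perfect matching of that path,
pairing offsets `(1,2), (3,4), …`. [cite: BraunPokuttaRoy2016, proof of Thm. 5.1 ("the unique extension of this
matching to a perfect matching by adding edges from the cycles `C^v`") (arXiv v3)] -/
def solPartner (x : DV k) : DV k :=
  if x.2 = pos M x.1 then cross x else if off M x % 2 = 1 then nxt x else prv x

/-- `M*` is a perfect matching of `D_N`: the partner map is an adjacency-respecting involution.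
[cite: BraunPokuttaRoy2016, proof of Thm. 5.1 (arXiv v3)] -/
theorem solPartner_spec (x : DV k) :
    (dGraph k).Adj x (solPartner M x) ∧ solPartner M (solPartner M x) = x := by
  have hk := even_k M
  have hoff := off_le M x
  by_cases h0 : x.2 = pos M x.1
  · have hs : solPartner M x = cross x := by simp [solPartner, h0]
    rw [hs]
    refine ⟨adj_cross x, ?_⟩
    obtain ⟨v, i⟩ := x
    simp only at h0
    subst h0
    rw [cross_pos]
    simp only [solPartner, if_true]
    rw [cross_pos, matchPartner_matchPartner]
  · have hne0 : off M x ≠ 0 := fun h => h0 ((off_eq_zero_iff M x).1 h)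
    by_cases hodd : off M x % 2 = 1
    · have hs : solPartner M x = nxt x := by simp [solPartner, h0, hodd]
      have hlt : off M x < k := by
        rcases hoff.lt_or_eq with h | h
        · exact h
        · exfalso; obtain ⟨j, hj⟩ := hk; omega
      have hn : off M (nxt x) = off M x + 1 := off_nxt M x hlt
      rw [hs]
      refine ⟨adj_nxt (nxt_ne (by omega) x), ?_⟩
      have h0' : (nxt x).2 ≠ pos M (nxt x).1 := fun h => by
        have := (off_eq_zero_iff M (nxt x)).2 h; omega
      have hev : ¬ (off M (nxt x) % 2 = 1) := by omega
      unfold solPartner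
      rw [if_neg h0', if_neg hev, prv_nxt]
    · have hs : solPartner M x = prv x := by simp [solPartner, h0, hodd]
      have hp : off M (prv x) = off M x - 1 := off_prv M x hne0
      rw [hs]
      refine ⟨adj_prv (prv_ne (by omega) x), ?_⟩
      have h0' : (prv x).2 ≠ pos M (prv x).1 := fun h => by
        have := (off_eq_zero_iff M (prv x)).2 h; omega
      have hod : off M (prv x) % 2 = 1 := by omega
      unfold solPartner
      rw [if_neg h0', if_pos hod, nxt_prv]

/-- **The image `M*` of a perfect matching of `K_N`**, a perfect matching of `D_N`.
[cite: BraunPokuttaRoy2016, proof of Thm. 5.1 (arXiv v3)] -/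
def solStar : PerfectMatching (dGraph k) :=
  ⟨partnerSubgraph (dGraph k) (solPartner M) (solPartner_spec M),
    partnerSubgraph_isPerfectMatching _ _ (solPartner_spec M)⟩

/-- The partner map of `M*` is `solPartner`. [folklore] -/
@[simp] private theorem matchPartner_solStar (x : DV k) : matchPartner (solStar M).2 x = solPartner M x :=
  Literature.Computability.Complexity.Rothvoss.matchPartner_partnerSubgraph (dGraph k) (solPartner M)
    (solPartner_spec M) x

/-- Which vertices of `D_N` have their `M*`-partner as an `H*`-neighbour: the matched positions `[v, M(v)]` with
`{v, M(v)} ∈ E(H)`, and all other positions of the cycles `C^v`, `v ∈ V(H)`.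
[cite: BraunPokuttaRoy2016, proof of Thm. 5.1 (value identity) (arXiv v3)] -/
theorem instStar_adj_solPartner (H : (⊤ : SimpleGraph (Fin (k + 2))).Subgraph) (x : DV k) :
    (instStar H).Adj x (solPartner M x) ↔
      (x.2 = pos M x.1 ∧ H.Adj x.1 (matchPartner M.2 x.1)) ∨ (x.2 ≠ pos M x.1 ∧ x.1 ∈ H.verts) := by
  have hadj := (solPartner_spec M x).1
  rw [instStar_adj]
  by_cases h0 : x.2 = pos M x.1
  · have hs : solPartner M x = cross x := by simp [solPartner, h0]
    have h1 : (cross x).1 = matchPartner M.2 x.1 := by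
      obtain ⟨v, i⟩ := x
      simp only at h0
      subst h0
      exact succAbove_pos M v
    rw [hs] at hadj ⊢
    rw [h1]
    have hne : x.1 ≠ matchPartner M.2 x.1 := (partner_ne M x.1).symm
    constructor
    · rintro ⟨-, ⟨h, -⟩ | h⟩
      · exact absurd h hne
      · exact Or.inl ⟨h0, h⟩
    · rintro (⟨-, h⟩ | ⟨h, -⟩)
      · exact ⟨hadj, Or.inr h⟩
      · exact absurd h0 h
  · have hs1 : (solPartner M x).1 = x.1 := by
      by_cases hodd : off M x % 2 = 1 <;> simp [solPartner, h0, hodd]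
    rw [hs1]
    have hloop : ¬ H.Adj x.1 x.1 := fun h => (SimpleGraph.top_adj _ _).1 (H.adj_sub h) rfl
    constructor
    · rintro ⟨-, ⟨-, h⟩ | h⟩
      · exact Or.inr ⟨h0, h⟩
      · exact absurd h hloop
    · rintro (⟨h, -⟩ | ⟨-, h⟩)
      · exact absurd h h0
      · exact ⟨hadj, Or.inl ⟨rfl, h⟩⟩

/-- **Counting**: `#{x : M*(x) ∈ N_{H*}(x)} = #{v : M(v) ∈ N_H(v)} + (N − 2)·|V(H)|`.
[cite: BraunPokuttaRoy2016, proof of Thm. 5.1 (value identity) (arXiv v3)] -/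
theorem card_filter_instStar (H : (⊤ : SimpleGraph (Fin (k + 2))).Subgraph) :
    (univ.filter fun x => (instStar H).Adj x (matchPartner (solStar M).2 x)).card =
      (univ.filter fun v => H.Adj v (matchPartner M.2 v)).card +
        k * (univ.filter fun v => v ∈ H.verts).card := by
  simp_rw [matchPartner_solStar, instStar_adj_solPartner]
  rw [filter_or, card_union_of_disjoint]
  · congr 1
    · refine card_bij' (fun x _ => x.1) (fun v _ => (v, pos M v)) (fun x hx => ?_) (fun v hv => ?_)
        (fun x hx => ?_) (fun v _ => rfl)
      · exact mem_filter.2 ⟨mem_univ _, (mem_filter.1 hx).2.2⟩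
      · exact mem_filter.2 ⟨mem_univ _, rfl, (mem_filter.1 hv).2⟩
      · exact Prod.ext rfl (mem_filter.1 hx).2.1.symm
    · rw [card_filter, Fintype.sum_prod_type]
      have hin : ∀ v : Fin (k + 2),
          (∑ i : Fin (k + 1), if ((v, i) : DV k).2 ≠ pos M ((v, i) : DV k).1 ∧ ((v, i) : DV k).1 ∈ H.verts
            then 1 else 0) = if v ∈ H.verts then k else 0 := by
        intro v
        by_cases hv : v ∈ H.verts
        · simp only [hv, and_true, if_true]
          rw [sum_boole, Nat.cast_id, filter_ne', card_erase_of_mem (mem_univ _), card_univ, Fintype.card_fin,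
            Nat.add_sub_cancel]
        · simp [hv]
      simp_rw [hin]
      rw [← sum_filter, sum_const, smul_eq_mul, mul_comm]
  · rw [disjoint_filter]
    intro x _ h1 h2
    exact h2.1 h1.1

/-- **The value identity** `2·val_{H*}(M*) = 2·val_H(M) + (N − 2)·|V(H)|`
(printed: `val_{H*}(M*) = |V(H)|·(n−1) + val_H(M)`, `N = 2n`).
[cite: BraunPokuttaRoy2016, proof of Thm. 5.1 (first display) (arXiv v3)] -/
theorem two_mul_matchingVal_star (H : (⊤ : SimpleGraph (Fin (k + 2))).Subgraph) :
    2 * matchingVal (dGraph k) (instStar H) (solStar M) =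
      2 * matchingVal ⊤ H M + k * (univ.filter fun v => v ∈ H.verts).card := by
  rw [two_mul_matchingVal, two_mul_matchingVal, card_filter_instStar]
  push_cast
  ring

/-- **Completeness of the reduction**: `C(H) − val_H(M) = C(H*) − val_{H*}(M*)` with `C(H) = ⌊|V(H)|/2⌋ + t`,
using `|V(H*)| = (2n−1)|V(H)|` and `⌊(2n−1)|V(H)|/2⌋ = (n−1)|V(H)| + ⌊|V(H)|/2⌋`.
[cite: BraunPokuttaRoy2016, proof of Thm. 5.1 (second display) (arXiv v3)] -/
theorem slack_eq (t : ℝ) (H : (⊤ : SimpleGraph (Fin (k + 2))).Subgraph) :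
    (matchingProblem (⊤ : SimpleGraph (Fin (k + 2))) t).C H - (matchingProblem ⊤ t).val H M =
      (matchingProblem (dGraph k) t).C (instStar H) -
        (matchingProblem (dGraph k) t).val (instStar H) (solStar M) := by
  obtain ⟨j, hj⟩ := even_k M
  set p := (univ.filter fun v => v ∈ H.verts).card with hp
  have h2 := two_mul_matchingVal_star M H
  simp only [matchingProblem_C, matchingProblem_val, ncard_instStar_verts, ncard_verts_eq H]
  rw [← hp] at h2 ⊢
  have hdiv : (k + 1) * p / 2 = j * p + p / 2 := by
    rw [hj, show (j + j + 1) * p = p + 2 * (j * p) by ring, Nat.add_mul_div_left _ _ two_pos, add_comm]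
  rw [hdiv]
  push_cast
  have hk : (k : ℝ) = 2 * j := by exact_mod_cast (hj.trans (two_mul j).symm)
  rw [hk] at h2
  linarith

end Sol

/-- **The reduction of Thm. 5.1** from `Matching(K_N)` to `Matching(D_N)` (affine, `M₁ ≡ 1`, `M₂ ≡ 0`), for every
shift `t` of the completeness guarantee `⌊|V(H)|/2⌋ + t` ("it suffices to use the affine framework of [BPZ2015]").
[cite: BraunPokuttaRoy2016, Thm. 5.1 and its proof (arXiv v3)] -/
def reduction (k : ℕ) (t : ℝ) :
    (matchingProblem (⊤ : SimpleGraph (Fin (k + 2))) t).Reduction (matchingProblem (dGraph k) t) :=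
  MaxProblem.Reduction.affine instStar solStar (fun _ => 1) (fun _ => 0) (fun _ => zero_le_one) (fun _ => le_rfl)
    (fun H M => by rw [one_mul, add_zero]; exact slack_eq M t H) (fun H _ => matchingProblem_sound _ _ _)

/-- **LP lower bounds travel along the reduction** (Thm. 5.1 via Thm. 3.2): if the `(⌊|V(H)|/2⌋ + t, OPT)`-slack
matrix of `Matching(K_N)` has no nonnegative factorization of size `R + 2`, then `Matching(D_N)` has no
`(⌊|V(H)|/2⌋ + t, OPT)`-approximate LP formulation of size `R`.
[cite: BraunPokuttaRoy2016, Thm. 5.1 (arXiv v3)] -/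
theorem isEmpty_lpFormulation_of_Kn (t : ℝ) {R : ℕ}
    (hno : ¬ HasNonnegFactorization
      (matchingProblem (⊤ : SimpleGraph (Fin (k + 2))) t).slackMatrix (R + 2)) :
    IsEmpty (LPFormulation (matchingProblem (dGraph k) t) R) :=
  (reduction k t).isEmpty_lpFormulation_affine (fun _ => 1) (fun _ => 0) (fun _ _ => rfl) (fun _ _ => rfl) hno

/-- **Thm. 5.1 (Matching over `3`-regular graphs has no small LPs), at the endpoint `ε → 1`, UNCONDITIONAL:**
there is `c > 0` such that for all large even `k` (`N = k + 2`; `D_N` is `3`-regular with `N(N−1)` vertices,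
`dGraph_isRegularOfDegree`, `card_DV`) and every `R ≤ 2^{ck}`, `Matching(D_N)` has no
`(⌊|V(H)|/2⌋, OPT(H))`-approximate LP formulation of size `R`.  (Printed for the guarantees
`(⌊|V(H)|/2⌋ + (1−ε)/2, OPT(H))`, `0 ≤ ε < 1`, which are STRONGER lower bounds resting on [BraunPokutta2014, Thm. 3.1] (Braun–Pokutta, SODA 2015, arXiv:1403.6710);
the endpoint proved here is the one implied by Rothvoss's theorem, see `matchingKn_not_hasNonnegFactorization`.)
[cite: BraunPokuttaRoy2016, Thm. 5.1 (arXiv v3)] [cite: Rothvoss2017, Thm. 1] -/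
theorem threeRegularMatching_lpFormulation_exp :
    ∃ c : ℝ, 0 < c ∧ ∀ᶠ k : ℕ in atTop, Even k → ∀ R : ℕ, (R : ℝ) ≤ 2 ^ (c * k) →
      IsEmpty (LPFormulation (matchingProblem (dGraph k) 0) R) := by
  obtain ⟨c, hc, hev⟩ := matchingKn_not_hasNonnegFactorization
  refine ⟨c / 2, half_pos hc, ?_⟩
  have hev' := (tendsto_add_atTop_nat 2).eventually hev
  filter_upwards [hev', eventually_rpow_half_add_two_le hc] with k hk h2 heven R hR
  refine isEmpty_lpFormulation_of_Kn 0 (hk (heven.add even_two) (R + 2) ?_)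
  have hmono : (2 : ℝ) ^ (c * k) ≤ 2 ^ (c * ((k + 2 : ℕ) : ℝ)) :=
    Real.rpow_le_rpow_of_exponent_le one_le_two (by push_cast; nlinarith)
  push_cast at hmono ⊢
  linarith

/-- **Thm. 5.1 in the printed shape `2^{Ω(√|V(D)|)}`** (endpoint `ε → 1`): for some `c > 0`, all large even `k`
and every `R ≤ 2^{c √|V(D_N)|}` there is no `(⌊|V(H)|/2⌋, OPT)`-approximate LP formulation of `Matching(D_N)` of
size `R` (`|V(D_N)| = N(N−1)`, `N = k+2`). [cite: BraunPokuttaRoy2016, Thm. 5.1 (arXiv v3)] [cite: Rothvoss2017, Thm. 1] -/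
theorem threeRegularMatching_lpFormulation_exp_card :
    ∃ c : ℝ, 0 < c ∧ ∀ᶠ k : ℕ in atTop, Even k → ∀ R : ℕ,
      (R : ℝ) ≤ 2 ^ (c * Real.sqrt (Fintype.card (DV k))) →
      IsEmpty (LPFormulation (matchingProblem (dGraph k) 0) R) := by
  obtain ⟨c, hc, hev⟩ := threeRegularMatching_lpFormulation_exp
  refine ⟨c / 2, half_pos hc, ?_⟩
  filter_upwards [hev, eventually_ge_atTop 2] with k hk hk2 heven R hR
  refine hk heven R (hR.trans (Real.rpow_le_rpow_of_exponent_le one_le_two ?_))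
  rw [card_DV]
  have hk2' : (2 : ℝ) ≤ k := by exact_mod_cast hk2
  have hsq : Real.sqrt (((k + 2) * (k + 1) : ℕ) : ℝ) ≤ 2 * k := by
    rw [Real.sqrt_le_iff]
    constructor
    · positivity
    · push_cast; nlinarith
  calc c / 2 * Real.sqrt (((k + 2) * (k + 1) : ℕ) : ℝ) ≤ c / 2 * (2 * k) :=
        mul_le_mul_of_nonneg_left hsq (by positivity)
    _ = c * k := by ring

end ThreeRegularMatching

end Literature.Combinatorics.Optimization

end
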